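import Summits.Schanuel.Schanuel.Theorems.RootDecomp1KThueMahler04

/-!
# RootDecomp1KParamThueMahler — lens 1, generation 56, NODE 17 «SIEGEL GENUS 0 ON THE K-LINE (Thue–Mahler on the parameter line)» (RULE K-R47 payable clause; CLAIM L2669, PRICE L2670, VERDICT L2680, K-R48) — part 1 (RootDecomp1KParamThueMahler01): §1 XParamTM and Theorem A, §2 the square-root uniformised curves and Theorem B

(lens-1 g56 NODE 17 HOME kernel K2 = HOME/decomp-schanuel-lens-1/g56/ParamThueMahler.lean 6128daf4…, 642 l, 87 thm + 8 def, imports tree …RootDecomp1KThueMahler04 ONLY = the port of node 16 (no Literature import, no fact def, no private / set_option); Probe / Ctrl0 / Ctrl + NODE-g56b.md + presearch_g56b.txt + SHA256SUMS; CLAIM L2669, crit EX-ANTE PRICE L2670 (ONE THEOREM ×1 under K-R47's payable clause «an infinite class of RE-AMENDED-FRONTIER pairs of x-degree ≥ 2 made unconditional … by a record input provably reaching where the record could not» iff CHECKLIST K-g56b; RULE K-R48 pre-announced), lens INFO L2671, NODE L2677, critic VERDICT L2680: CLEARED — THEOREM ×1 under K-R47's payable clause (EX-ANTE PRICE L2670),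 CHECKLIST K-g56b (1)–(10) MET, with ONE POST-HOC CONDITION OF RECORD (census files the LIVENESS rows «node17 Q17 / Qa 0 / Qa 1», key xParamTM, reading «rate 1 / exp ½ ⇒ FRONTIER at m₀ = 2, not x-linear, not killed» — FILED as census/LIVENESS-v7 e94537bf…/9b531c72…, INSTRUMENT NOTE 7 L2683: the rows read exactly so); RULE K-R48 FIXED (toolkit of record ∪= rational-uniformisation transfer (`XParamTM` shape, `param_of_point`) feeding `finite_dyadicPts`; FRONTIER re-amended by «NOT XParamTM-level-finite»; open territory of record at m₀ = 2 := re-amended-frontier pairs of x-degree ≥ 2 that are NOT XParamTM — positive-genus rate-1 members, standing witness M17P; UNCONDITIONAL PART := DecidedAt ∨ MachineDecidedAt ∨ LocalAt ∨ GaussAt ∨ XLinTM ∨ XParamTM); PORT GO (K2 verbatim; docstrings/provenance only; «cite-token» spelling; dedup 0; identity diff + tree farm by the successor critic crit-1 g10). Port by census-1 gen 22 as `RootDecomp1KParamThueMahler01–03` (`--supports stmt-Schanuel-33364`; no census credit): 01 = §1 the x-UNIFORMISED CLASS **`XParamTM P`** (∃ U V ∈ ℤ[t], V ℚ-separable, 3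 ≤ deg V, deg U ≤ deg V, U ⊥ V, ∃ E : Finset ℚ, ∀ C, ∃ C', every bounded non-degenerate rational point (x, r), x ∈ ℚ, has r ∈ E or x = U(t)/V(t) for some |t| ≤ C' with V(t) ≠ 0) and THEOREM A **`levelFinite_of_xParamTM : XParamTM P → LevelFinite P`**, `thinFibreAt_of_xParamTM` (every m₀), `xParamTM_of_xLinTM`, bridge `dyadicPt_of_level_param` into node 16's `finite_dyadicPts` + §2 THE SQUARE-ROOT UNIFORMISED CURVES `sqrtParamP U₀ U₁ V₀ V₁ = (U₀(Y) − x·V₀(Y))² − Y·(x·V₁(Y) − U₁(Y))²`, `twist`, `excR`, `param_of_point`, THEOREM B **`xParamTM_sqrtParamP`**, `levelFinite_sqrtParamP`, `thinFibreAt_sqrtParamP`; 02 = §3 the INFINITE x-DEGREE-2 FAMILY **`Qa a := sqrtParamP (C a) 1 (X² + C 2) 1`** (U = t + a, V = t⁴ + t + 2; common top Y⁴ + 4Y² − Y + 4): `xParamTM_Qa`, `levelFinite_Qa`, **`thinFibreAt_Qa (a) (m₀)` HYP-FREE**, the x-presentation `Qa_eq_xPolyP` / `qC` and the UNIFORM territory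 certificates `not_decidedAt_two_Qa`, `not_localAt_Qa`, `not_gaussAt_Qa`, `not_heightDecidedAt_two_Qa`, `not_xLinTM_Qa`, `Qa_ne_twoTermP`, `Qa_ne_normShapeCurve`, `sepTopAt_two_Qa`, `Qa_injective`, **`Qa_territory`**; 03 = the showcase member **`Q17 = Qa 3 = x²(Y⁴ + 4Y² − Y + 4) − 2x(3Y² − Y + 6) + (9 − Y)`**: `thinFibreAt_Q17_all`, `Q17_territory`, `natDegree_Qa_eq_two_mul_xdeg` (the machine cap as an equality). PORT EDITS: 45 one-line docstrings on undocumented computation lemmas (statements quoted); otherwise none (no dedup twin: K2's `abs_le_of_sq_le` is a different statement from `RootDecomp1KLevelFinite.abs_le_of_sq_le` and resolves in K2's own namespace exactly as in the lens's farm run; no private, no set_option, no cite-token in a def docstring); provenance doc blocks + continuation headers = K2's own open-lines; statements and proofs VERBATIM. Rung 0 — nothing here proves Schanuel, 33364, 33363, 31077 or ThinFibre 2; the class, the family and the member are HYPOTHESIS-FREE; M17P (positive genus) does not move.)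
-/

/-!
# RootDecomp1KParamThueMahler — lens 1, generation 56, NODE 17 «SIEGEL GENUS 0 ON THE K-LINE»
  (Thue–Mahler on the PARAMETER line; RULE K-R47 payable clause «an infinite class of RE-AMENDED-FRONTIER pairs OF x-DEGREE ≥ 2
  made unconditional … by a record input provably reaching where the record could not — say why»; CLAIM L2669, PRICE/CHECKLIST K-g56b L2670)

HONEST SCOPE (line 1).  ONE theorem-package on the K-line's thin-fibre residual `ThinFibreAt m₀ P` (tree
`RootDecomp1KDegreeLadder.ThinFibreAt`) with NO binder, NO hypothesis `def … : Prop` consumed, NO Literature fact assumed; the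
engine is node 16's THEOREM `RootDecomp1KThueMahler.finite_dyadicPts` (Thue–Mahler on the line, itself fed by the tree's Ridout
window).  Rung 0: nothing here proves Schanuel, `stmt-Schanuel-33364`, 31077, `ThinFibre 2`, `PadicSubspace`, `HeightComparison`,
`LocalOffAt 2`, `GaussOffAt 2`, `SiegelShapesOffAt 2` or `MachineOffAt 2`; no binder is touched or discharged.

THE THEOREM (A).  `XParamTM P → LevelFinite P` (`levelFinite_of_xParamTM`), hence `ThinFibreAt m₀ P` for EVERY `m₀`
(`thinFibreAt_of_xParamTM`), HYPOTHESIS-FREE, for the INTRINSIC class `XParamTM P`: there are `U, V ∈ ℤ[t]`, `V` separable over `ℚ`,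
`deg V ≥ 3`, `deg U ≤ deg V`, `U ⊥ V` over `ℚ`, and a FINITE exceptional set of ordinates `E : Finset ℚ`, such that for every window
`C` there is `C'` with: every rational point `(x, r)` of `P`, `|r| ≤ C`, non-degenerate fibre, has `r ∈ E` or `x = U(t)/V(t)` for a
rational `t`, `|t| ≤ C'`, `V(t) ≠ 0` (an x-UNIFORMISATION with ≥ 3 poles of `x`, counted with the separability of `V`).  PROOF: a level
point `(s_N, r)` off `E` gives `2^{N!}·U(t) − p_N·V(t) = 0`, i.e. a bounded DYADIC POINT of the pair `(U, V)` on the PARAMETER line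
(`DyadicPt U V 2 t`), of which there are finitely many with `|t| ≤ C'` (node 16 `finite_dyadicPts`); `N ↦ s_N` is injective; the
ordinates in `E` carry finitely many levels each (tree `levels_finite_of_nondeg`).  The record class is the sub-case `t = Y`:
`xParamTM_of_xLinTM : XLinTM P → XParamTM P` (consistency, no credit).
THE THEOREM (B).  The SQUARE-ROOT UNIFORMISED CURVES of x-degree 2, typed generally:
`sqrtParamP U₀ U₁ V₀ V₁ := (U₀(Y) − x·V₀(Y))² − Y·(x·V₁(Y) − U₁(Y))²` — the curve `x = U(t)/V(t)`, `Y = t²` with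
`U = twist U₀ U₁ = U₀(t²) + t·U₁(t²)`, `V = twist V₀ V₁` — are in `XParamTM` (`xParamTM_sqrtParamP`) as soon as `V` is ℚ-separable of
degree `≥ 3`, `deg U ≤ deg V`, `U ⊥ V` over `ℚ` and `excR := U₀V₁ − U₁V₀ ≠ 0` (the parameter map is not even); the INVERSE PARAMETER is
the explicit certificate `t = (U₀(r) − x·V₀(r))/(x·V₁(r) − U₁(r))` (`param_of_point`; on the other chart `excR(r) = 0`: the finite `E`).
Hence `levelFinite_sqrtParamP`, `thinFibreAt_sqrtParamP … (m₀)`, hypothesis-free.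
THE INFINITE x-DEGREE-2 FAMILY `Qa a` (`a ∈ ℤ`): `U = t + a`, `V = t⁴ + t + 2` —
`Qa a = (a − x(Y²+2))² − Y(x−1)² = x²·(Y⁴ + 4Y² − Y + 4) − 2x·(aY² − Y + 2a) + (a² − Y)` (`Qa_eq_xPolyP`), showcase
`Q17 := Qa 3 = x²(Y⁴+4Y²−Y+4) − 2x(3Y²−Y+6) + (9−Y)`; `thinFibreAt_Qa (a) (m₀)`, `levelFinite_Qa`, hyp-free, and the TERRITORY
certificates UNIFORM in `a` by TREE names (`Qa_territory`): `xdeg = 2`, `deg_Y = 4`, the common top `c₂ = Y⁴ + 4Y² − Y + 4 = N(V)` is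
ℚ-SEPARABLE with a `ℤ₂`-ROOT (Hensel at `0`, typed) and NO rational root, `eTop = 0`; `¬ DecidedAt 2`, `¬ LocalAt 2`, `¬ GaussAt 2`
(dominance fails at `j = 2`), `¬ HeightDecidedAt 2` — indeed `deg_Y = 2·xdeg` EXACTLY: node 12/13's strict height inequality is an
EQUALITY on the family (`natDegree_Qa_eq_two_mul_xdeg`; likewise `deg φ = 4 = 2·deg ψ` for the uniformisation, so `ParamAt 2` /
`CorrAt 2` are unavailable by the machine's own count — `MachineDecidedAt 2` is NOT refuted by name: the tree has no
composition-degree lemma; CAP STATED) —, `¬ XLinTM`, `¬ XLinearLt`, no x-linear / two-term / norm-shape presentation,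
`3 ≤ thinThreshold`; HONESTY: `SepTopAt 2 (Qa a)` HOLDS (node 11 decided the family CONDITIONALLY on `PadicSubspace`, as `M17P`).
WHY THE RECORD COULD NOT (K-R47 «say why»): (a) `XLinTM` / `thinFibreAt_xLinear_sep3_or_lt` are x-linear BY STATEMENT
(`not_xLinTM_Qa`); (b) on x-degree `k ≥ 2` the level identity `Σ_j p_N^j 2^{(k−j)N!} F_j = 0` has the free odd `p_N` in the
non-top forms, so the odd part of `F_top` is bounded by no resultant (node 15/16's recorded dead end, `M17P`) — the uniformising
parameter `t` RESTORES the two-term shape `2^{N!}U(t) = p_N V(t)` on the `t`-line; (c) node 13's height machine is capped at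
`deg_Y < m₀·xdeg` (equality here: `not_heightDecidedAt_two_Qa`).
NOT reached (said so): positive-genus rate-1 members (`M17P`, genus 2 — the standing conditional-only witness), genus-0 members whose
uniformisation needs `Y = W(t)/D(t)` or x-degree ≥ 3 (not typed here; reachable by the same transfer — K-R48), `ThinFibre 2`,
33364, 31077, Schanuel.
SOURCES (cite-token; no problem-relative novelty claimed for the number theory — this is the classical GENUS-0 CASE OF SIEGEL'S
THEOREM, `≥ 3` poles ⇒ Thue–Mahler / S-unit equation —, only for the K-line reach): C. L. Siegel, Abh. Preuss. Akad. Wiss. 1929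
Nr. 1; K. Mahler, Math. Ann. 107 (1933) 691–730; S. Lang, Fundamentals of Diophantine Geometry (1983) Ch. 8 §5; Bombieri–Gubler,
Heights in Diophantine Geometry (2006) Thm 7.3.9 / Rem 7.3.10 (p. 179); U. Zannier, Lecture Notes on Diophantine Analysis (EMS 2024)
pp. 93, 100–101; D. Poulakis, Acta Math. Hungar. 93 (2001) (doi:10.1023/a:1017971406157); Alvanos–Bilu–Poulakis 2009 Thm 1.1
(arXiv:0907.2097) — the very sources of the tree's `[hypothesis]` trichotomy `SiegelShapes` (LevelFinite02), whose case (A)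
conclusion node 17 PROVES on `XParamTM` members.
-/

noncomputable section

namespace Summit.Schanuel.Schanuel.Theorems.RootDecomp1KParamThueMahler

open Polynomial LiouvilleNumber
open scoped Nat
open Summit.Schanuel.Schanuel.Theorems.RootDecomp1KTwoBaseCell (psNumer)
open Summit.Schanuel.Schanuel.Theorems.RootDecomp1KDegreeLadder
open Summit.Schanuel.Schanuel.Theorems.RootDecomp1KXLinear
open Summit.Schanuel.Schanuel.Theorems.RootDecomp1KXLinearII
open Summit.Schanuel.Schanuel.Theorems.RootDecomp1KXAll
open Summit.Schanuel.Schanuel.Theorems.RootDecomp1KLevelFinite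
open Summit.Schanuel.Schanuel.Theorems.RootDecomp1KSubspaceBranch
open Summit.Schanuel.Schanuel.Theorems.RootDecomp1KXTop
open Summit.Schanuel.Schanuel.Theorems.RootDecomp1KLocalExponent
open Summit.Schanuel.Schanuel.Theorems.RootDecomp1KIntegrality
open Summit.Schanuel.Schanuel.Theorems.RootDecomp1KHeightGrading
open Summit.Schanuel.Schanuel.Theorems.RootDecomp1KHeightMachine
open Summit.Schanuel.Schanuel.Theorems.RootDecomp1KRelLiouvilleCell (partialSum_two_strictMono)
open Summit.Schanuel.Schanuel.Theorems.RootDecomp1KThueMahler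

/-! ## §1  THE x-UNIFORMISED CLASS `XParamTM` AND THEOREM A (Siegel genus 0 on the K-line) -/

/-- [class] statement def (census convention): **the x-UNIFORMISED Thue–Mahler class.**  There are `U, V ∈ ℤ[t]` with
`V` separable over `ℚ`, `deg V ≥ 3`, `deg U ≤ deg V`, `U ⊥ V` over `ℚ`, and a FINITE exceptional set `E ⊂ ℚ` of
ordinates such that for every `C` there is `C'` with: every RATIONAL point `(x, r)` of `P` with `|r| ≤ C` and
non-degenerate fibre has `r ∈ E` or `x = U(t)/V(t)` for a rational parameter `t`, `|t| ≤ C'`, `V(t) ≠ 0`. -/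
def XParamTM (P : ℤ[X][X]) : Prop :=
  ∃ U V : ℤ[X], (V.map (Int.castRingHom ℚ)).Separable ∧ 3 ≤ V.natDegree ∧ U.natDegree ≤ V.natDegree ∧
    IsCoprime (U.map (Int.castRingHom ℚ)) (V.map (Int.castRingHom ℚ)) ∧
    ∃ E : Finset ℚ, ∀ C : ℝ, ∃ C' : ℝ, ∀ x r : ℚ, |(r : ℝ)| ≤ C → bev P x r = 0 →
      (∃ x' : ℝ, bev P x' r ≠ 0) → r ∈ E ∨ ∃ t : ℚ, |(t : ℝ)| ≤ C' ∧ aeval t V ≠ 0 ∧ x * aeval t V = aeval t U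

/-- the parametrisation clause in quotient form: `x·V(t) = U(t)` with `V(t) ≠ 0` iff `x = U(t)/V(t)`. -/
theorem mul_eq_iff_eq_div {x u v : ℚ} (hv : v ≠ 0) : x * v = u ↔ x = u / v := (eq_div_iff hv).symm

/-- the truncation `s_N` as a rational number. -/
theorem partialSum_two_eq_ratCast (N : ℕ) :
    partialSum 2 N = (((psNumer 2 N : ℚ) / 2 ^ N ! : ℚ) : ℝ) := by
  rw [lac_partialSum_two]; push_cast; rfl

/-- a rational parameter `t` with `s_N·V(t) = U(t)`, `V(t) ≠ 0` is a bounded dyadic point of the pair `(U, V)` (`M = 2`). -/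
theorem dyadicPt_of_level_param {U V : ℤ[X]} {N : ℕ} {t : ℚ} (hV : aeval t V ≠ 0)
    (h : ((psNumer 2 N : ℚ) / 2 ^ N !) * aeval t V = aeval t U) : DyadicPt U V 2 t := by
  refine ⟨hV, -((psNumer 2 N : ℕ) : ℤ), N !, ?_, ?_⟩
  · have h1 := psNumer_lt N
    have h2 : ((psNumer 2 N : ℕ) : ℝ) < 2 * 2 ^ N ! := by exact_mod_cast h1
    rw [Int.cast_neg, Int.cast_natCast, abs_neg, abs_of_nonneg (by positivity)]
    exact h2.le
  · have h2 : (2 : ℚ) ^ N ! ≠ 0 := by positivity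
    have key : (2 : ℚ) ^ N ! * ((psNumer 2 N : ℚ) / 2 ^ N ! * aeval t V) = (psNumer 2 N : ℚ) * aeval t V := by
      field_simp
    have : (2 : ℚ) ^ N ! * aeval t U = (psNumer 2 N : ℚ) * aeval t V := by rw [← h, key]
    push_cast
    linarith

/-- **THEOREM A — SIEGEL GENUS 0 ON THE K-LINE: `XParamTM P → LevelFinite P`, HYPOTHESIS-FREE.** -/
theorem levelFinite_of_xParamTM {P : ℤ[X][X]} (h : XParamTM P) : LevelFinite P := by
  classical
  obtain ⟨U, V, hsep, hn, hle, hcop, E, hunif⟩ := h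
  intro C
  obtain ⟨C', hC'⟩ := hunif C
  have hT := finite_dyadicPts U V hsep hn hle hcop C' 2
  have h1 : (⋃ r ∈ (E : Set ℚ), {N : ℕ | bev P (partialSum 2 N) r = 0 ∧ ∃ x : ℝ, bev P x r ≠ 0}).Finite := by
    refine E.finite_toSet.biUnion fun r _ => ?_
    by_cases hnd : ∃ x : ℝ, bev P x r ≠ 0
    · exact (levels_finite_of_nondeg P r hnd).subset fun N hN => hN.1
    · exact Set.finite_empty.subset fun N hN => (hnd hN.2).elim
  have h2 : (⋃ t ∈ {t : ℚ | |(t : ℝ)| ≤ C' ∧ DyadicPt U V 2 t},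
      {N : ℕ | partialSum 2 N = (((aeval t U / aeval t V : ℚ)) : ℝ)}).Finite := by
    refine hT.biUnion fun t _ => ?_
    exact Set.Subsingleton.finite fun N hN M hM => partialSum_two_strictMono.injective (hN.trans hM.symm)
  refine (h1.union h2).subset ?_
  rintro N ⟨r, hrC, hP, hnd⟩
  have hP' : bev P ((((psNumer 2 N : ℚ) / 2 ^ N ! : ℚ) : ℝ)) r = 0 := by rwa [← partialSum_two_eq_ratCast]
  rcases hC' _ r hrC hP' hnd with hrE | ⟨t, htC, hVt, hxt⟩
  · exact Or.inl (Set.mem_biUnion (Finset.mem_coe.mpr hrE) ⟨hP, hnd⟩)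
  · refine Or.inr (Set.mem_biUnion (x := t) ⟨htC, dyadicPt_of_level_param hVt hxt⟩ ?_)
    show partialSum 2 N = (((aeval t U / aeval t V : ℚ)) : ℝ)
    rw [partialSum_two_eq_ratCast, eq_div_iff hVt |>.mpr hxt]

/-- **`XParamTM P → ThinFibreAt m₀ P` for EVERY `m₀`, HYPOTHESIS-FREE.** -/
theorem thinFibreAt_of_xParamTM {P : ℤ[X][X]} (h : XParamTM P) (m₀ : ℕ) : ThinFibreAt m₀ P :=
  thinFibreAt_of_levelFinite (levelFinite_of_xParamTM h) m₀

/-- the record class is the sub-case `t = Y`, `E = ∅`: **`XLinTM P → XParamTM P`**. -/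
theorem xParamTM_of_xLinTM {P : ℤ[X][X]} (h : XLinTM P) : XParamTM P := by
  obtain ⟨A, B, hsep, hn, hle, hcop, rfl⟩ := h
  refine ⟨-A, B, hsep, hn, by rwa [natDegree_neg], by rwa [Polynomial.map_neg, IsCoprime.neg_left_iff], ∅,
    fun C => ⟨C, fun x r hrC hP hnd => Or.inr ⟨r, hrC, ?_, ?_⟩⟩⟩
  · exact aeval_B_ne_zero_of_nondeg hP hnd
  · have h1 : ((aeval r A + x * aeval r B : ℚ) : ℝ) = 0 := by
      rw [bev_xLinP] at hP; push_cast; rw [aeval_ratCast, aeval_ratCast]; exact hP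
    have h2 : aeval r A + x * aeval r B = 0 := by exact_mod_cast h1
    rw [map_neg]; linarith

/-! ## §2  THE SQUARE-ROOT UNIFORMISED CURVES (x-degree 2): `(U₀(Y) − x·V₀(Y))² − Y·(x·V₁(Y) − U₁(Y))²` -/

/-- the `t`-polynomial `W₀(t²) + t·W₁(t²)` with even part `W₀` and odd part `W₁`. -/
def twist (W₀ W₁ : ℤ[X]) : ℤ[X] := expand ℤ 2 W₀ + X * expand ℤ 2 W₁

/-- `aeval t (twist W₀ W₁) = aeval (t ^ 2) W₀ + t * aeval (t ^ 2) W₁` in any commutative `ℤ`-algebra. -/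
theorem aeval_twist {R : Type*} [CommRing R] [Algebra ℤ R] (W₀ W₁ : ℤ[X]) (t : R) :
    aeval t (twist W₀ W₁) = aeval (t ^ 2) W₀ + t * aeval (t ^ 2) W₁ := by
  rw [twist, map_add, map_mul, aeval_X, expand_aeval, expand_aeval]

/-- read-back: `twist W₀ W₁ = W₀(t²) + t·W₁(t²)` as a composition. -/
theorem twist_eq_comp (W₀ W₁ : ℤ[X]) : twist W₀ W₁ = W₀.comp (X ^ 2) + X * W₁.comp (X ^ 2) := by
  rw [twist, expand_eq_comp_X_pow, expand_eq_comp_X_pow]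

/-- **the square-root uniformised curve** of the data `(U₀, U₁, V₀, V₁)`: the image of `t ↦ (x, Y) = (U(t)/V(t), t²)`,
`U = twist U₀ U₁`, `V = twist V₀ V₁`; as a polynomial, `(U₀(Y) − x·V₀(Y))² − Y·(x·V₁(Y) − U₁(Y))²`. -/
def sqrtParamP (U₀ U₁ V₀ V₁ : ℤ[X]) : ℤ[X][X] :=
  (Polynomial.map C U₀ - C X * Polynomial.map C V₀) ^ 2 - X * (C X * Polynomial.map C V₁ - Polynomial.map C U₁) ^ 2

/-- `bev (sqrtParamP U₀ U₁ V₀ V₁) x y = (U₀(y) - x * V₀(y)) ^ 2 - y * (x * V₁(y) - U₁(y)) ^ 2`. -/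
theorem bev_sqrtParamP (U₀ U₁ V₀ V₁ : ℤ[X]) (x y : ℝ) :
    bev (sqrtParamP U₀ U₁ V₀ V₁) x y =
      (aeval y U₀ - x * aeval y V₀) ^ 2 - y * (x * aeval y V₁ - aeval y U₁) ^ 2 := by
  simp only [sqrtParamP, bev_sub, bev_pow, bev_mul, bev_map_C, bev_C, bev_X, aeval_X]

/-- the resultant-type polynomial `R = U₀V₁ − U₁V₀` whose rational roots are the exceptional ordinates. -/
def excR (U₀ U₁ V₀ V₁ : ℤ[X]) : ℤ[X] := U₀ * V₁ - U₁ * V₀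

/-- the rational roots of a non-zero integer polynomial form a finite set. -/
theorem finite_ratRoots {R : ℤ[X]} (hR : R ≠ 0) : {r : ℚ | aeval r R = 0}.Finite :=
  (R.rootSet_finite ℚ).subset fun _ hr => mem_rootSet.mpr ⟨hR, hr⟩

/-- **THE INVERSE PARAMETER.**  A rational point `(x, r)` of `sqrtParamP U₀ U₁ V₀ V₁` with `x·V₁(r) ≠ U₁(r)` comes from the
rational parameter `t = (U₀(r) − x·V₀(r))/(x·V₁(r) − U₁(r))`: `t² = r` and `x·V(t) = U(t)`; on the chart `x·V₁(r) = U₁(r)`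
the equation forces `x·V₀(r) = U₀(r)` too, hence `R(r) = 0`. -/
theorem param_of_point (U₀ U₁ V₀ V₁ : ℤ[X]) {x r : ℚ} (hP : bev (sqrtParamP U₀ U₁ V₀ V₁) x r = 0) :
    aeval r (excR U₀ U₁ V₀ V₁) = 0 ∨
      ∃ t : ℚ, t ^ 2 = r ∧ x * aeval t (twist V₀ V₁) = aeval t (twist U₀ U₁) := by
  have hQ : (aeval r U₀ - x * aeval r V₀) ^ 2 - r * (x * aeval r V₁ - aeval r U₁) ^ 2 = 0 := by
    have h1 : (((aeval r U₀ - x * aeval r V₀) ^ 2 - r * (x * aeval r V₁ - aeval r U₁) ^ 2 : ℚ) : ℝ) = 0 := by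
      rw [bev_sqrtParamP] at hP; push_cast; simp only [aeval_ratCast]; exact hP
    exact_mod_cast h1
  by_cases hc : x * aeval r V₁ - aeval r U₁ = 0
  · left
    have h0 : aeval r U₀ - x * aeval r V₀ = 0 := by
      rw [hc] at hQ; simpa using hQ
    rw [excR, map_sub, map_mul, map_mul]
    have e1 : aeval r U₁ = x * aeval r V₁ := by linarith [sub_eq_zero.mp hc]
    have e0 : aeval r U₀ = x * aeval r V₀ := sub_eq_zero.mp h0
    rw [e1, e0]; ring
  · right
    set t : ℚ := (aeval r U₀ - x * aeval r V₀) / (x * aeval r V₁ - aeval r U₁) with ht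
    have key : t * (x * aeval r V₁ - aeval r U₁) = aeval r U₀ - x * aeval r V₀ := div_mul_cancel₀ _ hc
    have ht2 : t ^ 2 = r := by
      have h3 : (x * aeval r V₁ - aeval r U₁) ^ 2 ≠ 0 := pow_ne_zero 2 hc
      apply mul_right_cancel₀ h3
      rw [← mul_pow, key]
      exact sub_eq_zero.mp hQ
    refine ⟨t, ht2, ?_⟩
    rw [aeval_twist, aeval_twist, ht2]
    linear_combination key

/-- the square root of a rational of absolute value `≤ C` has absolute value `≤ max C 1`. -/
theorem abs_le_of_sq_le {t : ℚ} {C : ℝ} (h : |((t ^ 2 : ℚ) : ℝ)| ≤ C) : |(t : ℝ)| ≤ max C 1 := by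
  by_cases ht : |(t : ℝ)| ≤ 1
  · exact ht.trans (le_max_right _ _)
  · push Not at ht
    have h1 : |(t : ℝ)| ≤ |(t : ℝ)| ^ 2 := by nlinarith [abs_nonneg (t : ℝ)]
    have h2 : |(t : ℝ)| ^ 2 = |((t ^ 2 : ℚ) : ℝ)| := by push_cast; rw [abs_pow]
    exact (h1.trans (h2 ▸ h)).trans (le_max_left _ _)

/-- **THEOREM B (class membership)**: the square-root uniformised curves are in `XParamTM` — `V = twist V₀ V₁` separable
over `ℚ` of degree `≥ 3`, `deg U ≤ deg V`, `U ⊥ V`, and `U₀V₁ ≠ U₁V₀` (the parameter map `x(t)` is not even). -/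
theorem xParamTM_sqrtParamP (U₀ U₁ V₀ V₁ : ℤ[X])
    (hsep : ((twist V₀ V₁).map (Int.castRingHom ℚ)).Separable) (hn : 3 ≤ (twist V₀ V₁).natDegree)
    (hle : (twist U₀ U₁).natDegree ≤ (twist V₀ V₁).natDegree)
    (hcop : IsCoprime ((twist U₀ U₁).map (Int.castRingHom ℚ)) ((twist V₀ V₁).map (Int.castRingHom ℚ)))
    (hR : excR U₀ U₁ V₀ V₁ ≠ 0) : XParamTM (sqrtParamP U₀ U₁ V₀ V₁) := by
  classical
  refine ⟨twist U₀ U₁, twist V₀ V₁, hsep, hn, hle, hcop, (finite_ratRoots hR).toFinset,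
    fun C => ⟨max C 1, fun x r hrC hP _ => ?_⟩⟩
  rcases param_of_point U₀ U₁ V₀ V₁ hP with hE | ⟨t, ht2, hxt⟩
  · exact Or.inl ((finite_ratRoots hR).mem_toFinset.mpr hE)
  · refine Or.inr ⟨t, ?_, ?_, hxt⟩
    · exact abs_le_of_sq_le (by rwa [ht2])
    · intro hV0
      rw [hV0, mul_zero] at hxt
      rcases aeval_ne_zero_or_of_isCoprime hcop t with h | h
      · exact h hxt.symm
      · exact h hV0

/-- **THEOREM B: the square-root uniformised curves are LEVEL-FINITE, HYPOTHESIS-FREE.** -/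
theorem levelFinite_sqrtParamP (U₀ U₁ V₀ V₁ : ℤ[X])
    (hsep : ((twist V₀ V₁).map (Int.castRingHom ℚ)).Separable) (hn : 3 ≤ (twist V₀ V₁).natDegree)
    (hle : (twist U₀ U₁).natDegree ≤ (twist V₀ V₁).natDegree)
    (hcop : IsCoprime ((twist U₀ U₁).map (Int.castRingHom ℚ)) ((twist V₀ V₁).map (Int.castRingHom ℚ)))
    (hR : excR U₀ U₁ V₀ V₁ ≠ 0) : LevelFinite (sqrtParamP U₀ U₁ V₀ V₁) :=
  levelFinite_of_xParamTM (xParamTM_sqrtParamP U₀ U₁ V₀ V₁ hsep hn hle hcop hR)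

/-- **… hence `ThinFibreAt m₀` at EVERY `m₀` (incl. `m₀ = 2`), HYPOTHESIS-FREE.** -/
theorem thinFibreAt_sqrtParamP (U₀ U₁ V₀ V₁ : ℤ[X])
    (hsep : ((twist V₀ V₁).map (Int.castRingHom ℚ)).Separable) (hn : 3 ≤ (twist V₀ V₁).natDegree)
    (hle : (twist U₀ U₁).natDegree ≤ (twist V₀ V₁).natDegree)
    (hcop : IsCoprime ((twist U₀ U₁).map (Int.castRingHom ℚ)) ((twist V₀ V₁).map (Int.castRingHom ℚ)))
    (hR : excR U₀ U₁ V₀ V₁ ≠ 0) (m₀ : ℕ) : ThinFibreAt m₀ (sqrtParamP U₀ U₁ V₀ V₁) :=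
  thinFibreAt_of_levelFinite (levelFinite_sqrtParamP U₀ U₁ V₀ V₁ hsep hn hle hcop hR) m₀

end Summit.Schanuel.Schanuel.Theorems.RootDecomp1KParamThueMahler

end
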